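import Mathlib
import Summits.KontsevichZagierPeriods.KontsevichZagierPeriods.Theses.SymplecticScissors
import Summits.KontsevichZagierPeriods.KontsevichZagierPeriods.Theorems.SymplecticScissorsStackingShear
import Literature.NumberTheory.Transcendental.KZCalculusProofs
import Literature.NumberTheory.Transcendental.SemialgebraicMapsProofs

/-!
# `VolumeForm` (stmt-KontsevichZagierPeriods-3814), line `Sketch` — stub `stub_subgraphStacking`

STACKING OF PLANAR SUBGRAPHS (the analytic half of the reduction of finite unions of triangular
stacks to one planar set). For `k` non-negative `ℚ`-semialgebraic `C¹` functions `αᵢ` on `(a, b)`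
and integrand-`1` representations `Sᵢ` on their open subgraphs `{a < t < b, 0 < σ < αᵢ t}`, the
integrand-`1` representation `T` on the open subgraph of `∑ αᵢ` EXISTS and
`[T] − ∑ᵢ [Sᵢ] ∈ KZ.relations`.

Moves. Existence: the subgraph is `ℚ`-semialgebraic (graph elimination, Tarski–Seidenberg) and its
area is `∫_{(a,b)} ∑ αᵢ = ∑ area Sᵢ < ∞` (`volume_regionBetween_eq_lintegral` transported along the
measure-preserving `MeasurableEquiv.finTwoArrow`). Relation: induction on `k`; the step
`[subgraph (f + g)] − [subgraph f] − [subgraph g]` is the landed engine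
`StackingShear.stackingShear_proof` (cut along the graph of the partial sum `f` (rule 1a), shear
the upper band down by `f` (rule 2, `det = 1`), discard a null segment (rule 1a)), whose target
subgroup is generated by instances of rules (1a)/(2) and hence lies in `KZ.relations`; the empty
sum (`k = 0`) is the empty subgraph, a null representation.

Sources: M. Kontsevich, D. Zagier, *Periods* (2001), §1.2, rules (1)–(2); Bochnak–Coste–Roy 1998,
§2.2 (Tarski–Seidenberg); the rest is folklore calculus (Tonelli).
-/

noncomputable section

open scoped BigOperators
open Set MeasureTheory MvPolynomial
open Literature.NumberTheory.Transcendental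
open Literature.ModelTheory.ExponentialFields (IsSemialgebraic isSemialgebraic_empty
  isSemialgebraic_setOf_eval_pos tarski_seidenberg_real_holds)

namespace Summit.KontsevichZagierPeriods.SymplecticScissors.VolumeForm

open Summit.KontsevichZagierPeriods.KontsevichZagierPeriods.Theses.SymplecticScissors (PlanarAreas)

/-- The planar set-chain group generated by the instances of rules (1a)/(2) among integrand-`1`
planar representations (the target subgroup of `StackingShear`) lies in `KZ.relations`.
[folklore] -/
theorem sgStack_shearGroup_le_relations :
    AddSubgroup.closure ((KZ.domainAddRel ∪ KZ.changeOfVariablesRel) ∩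
        (AddSubgroup.closure {x : KZ.FormalRep | ∃ s : KZ.IntegralRep 2,
          (∀ p ∈ s.domain, s.integrand p = 1) ∧ x = KZ.of s} : Set KZ.FormalRep)) ≤
      KZ.relations := by
  refine (AddSubgroup.closure_le _).2 ?_
  rintro x ⟨hx | hx, -⟩
  · exact KZ.domainAddRel_subset_relations hx
  · exact KZ.changeOfVariablesRel_subset_relations hx

/-- The open subgraph `{(t, σ) | a < t < b, 0 < σ < F t}` of a `ℚ`-semialgebraic function on
`(a, b)` is `ℚ`-semialgebraic (graph elimination, Tarski–Seidenberg). [folklore] -/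
theorem sgStack_isSemialgebraic_subgraph {a b : ℝ} {F : ℝ → ℝ}
    (hFs : IsSemialgebraicFunOn ℚ {z : Fin 1 → ℝ | z 0 ∈ Ioo a b} (fun z => F (z 0))) :
    IsSemialgebraic ℚ {q : Fin 2 → ℝ | q 0 ∈ Ioo a b ∧ 0 < q 1 ∧ q 1 < F (q 0)} := by
  have hI : IsSemialgebraic ℚ {z : Fin 1 → ℝ | z 0 ∈ Ioo a b} :=
    IsSemialgebraicFunOn.isSemialgebraic_holds hFs
  have h1 : IsSemialgebraic ℚ {q : Fin 2 → ℝ | 0 < q 1} := by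
    simpa using isSemialgebraic_setOf_eval_pos (k := ℚ) (R := ℝ) (X 1 : MvPolynomial (Fin 2) ℚ)
  convert h1.inter (hI.setOf_init_mem.diff
    (hFs.isSemialgebraic_setOf_ge tarski_seidenberg_real_holds)) using 1
  ext q
  have e0 : Fin.init q 0 = q 0 := rfl
  have e1 : q (Fin.last 1) = q 1 := rfl
  simp only [mem_setOf_eq, mem_inter_iff, mem_sdiff, e0, e1, not_and, not_le]
  tauto

/-- The area of the open subgraph `{(t, σ) | a < t < b, 0 < σ < F t}` of a function continuous on
`(a, b)` is `∫_{(a,b)} F⁺` (Tonelli; `volume_regionBetween_eq_lintegral` transported along the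
measure-preserving `MeasurableEquiv.finTwoArrow`). [folklore] -/
theorem sgStack_volume_subgraph {a b : ℝ} {F : ℝ → ℝ} (hF : ContinuousOn F (Ioo a b)) :
    volume {q : Fin 2 → ℝ | q 0 ∈ Ioo a b ∧ 0 < q 1 ∧ q 1 < F (q 0)} =
      ∫⁻ t in Ioo a b, ENNReal.ofReal (F t) := by
  have hset : {q : Fin 2 → ℝ | q 0 ∈ Ioo a b ∧ 0 < q 1 ∧ q 1 < F (q 0)} =
      MeasurableEquiv.finTwoArrow ⁻¹' regionBetween (fun _ => 0) F (Ioo a b) := by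
    ext q
    simp [regionBetween, MeasurableEquiv.finTwoArrow_apply]
  rw [hset, (volume_preserving_finTwoArrow ℝ).measure_preimage_equiv, Measure.volume_eq_prod,
    volume_regionBetween_eq_lintegral aemeasurable_const (hF.aemeasurable measurableSet_Ioo)
      measurableSet_Ioo]
  simp only [Pi.sub_apply, sub_zero]

/-- Finite sums of real `ℚ`-semialgebraic functions on a `ℚ`-semialgebraic set are
`ℚ`-semialgebraic (Tarski–Seidenberg, by induction). [folklore] -/
theorem sgStack_isSemialgebraicFunOn_sum {m : ℕ} {s : Set (Fin m → ℝ)} (hs : IsSemialgebraic ℚ s) :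
    ∀ (k : ℕ) (φ : Fin k → (Fin m → ℝ) → ℝ), (∀ i, IsSemialgebraicFunOn ℚ s (φ i)) →
      IsSemialgebraicFunOn ℚ s (fun z => ∑ i, φ i z) := by
  intro k
  induction k with
  | zero =>
    intro φ _
    simpa using isSemialgebraicFunOn_ratCast hs 0
  | succ k ih =>
    intro φ hφ
    refine (IsSemialgebraicFunOn.add_holds (ih (fun i => φ (Fin.castSucc i)) fun i => hφ _)
      (hφ (Fin.last k))).congr fun z _ => ?_
    simp only [Pi.add_apply, Fin.sum_univ_castSucc]

/-- **Stacking of planar subgraphs.** For `k` non-negative `ℚ`-semialgebraic `C¹` functions `αᵢ`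
on `(a, b)` and integrand-`1` representations `Sᵢ` on their open subgraphs, the integrand-`1`
representation `T` on the open subgraph of `∑ αᵢ` exists (its area is `∑ area Sᵢ`) and
`[T] − ∑ [Sᵢ] ∈ KZ.relations`: induction on `k`, the step being the stacking shear
`[subgraph (f + g)] ≡ [subgraph f] + [subgraph g]` (cut along the graph of the `C¹` partial sum
`f` by rule (1a), shear the upper band down by `f` by rule (2) with `det = 1`, discard a null
segment), i.e. the landed `StackingShear.stackingShear_proof`, whose target subgroup lies in
`KZ.relations`. [cite: KontsevichZagier2001, §1.2 rules (1)–(2)] -/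
theorem stub_subgraphStacking : ∀ (k : ℕ) (a b : ℝ) (α : Fin k → ℝ → ℝ) (S : Fin k → KZ.IntegralRep 2),
    a < b →
    (∀ i, IsSemialgebraicFunOn ℚ {z : Fin 1 → ℝ | z 0 ∈ Set.Ioo a b} (fun z => α i (z 0))) →
    (∀ i, ContDiffOn ℝ 1 (α i) (Set.Ioo a b)) →
    (∀ i, ∀ t ∈ Set.Ioo a b, 0 ≤ α i t) →
    (∀ i, (S i).domain = {q | q 0 ∈ Set.Ioo a b ∧ 0 < q 1 ∧ q 1 < α i (q 0)}) →
    (∀ i, ∀ q ∈ (S i).domain, (S i).integrand q = 1) →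
    ∃ T : KZ.IntegralRep 2,
      T.domain = {q | q 0 ∈ Set.Ioo a b ∧ 0 < q 1 ∧ q 1 < ∑ i, α i (q 0)} ∧
      (∀ q ∈ T.domain, T.integrand q = 1) ∧ KZ.of T - ∑ i, KZ.of (S i) ∈ KZ.relations := by
  intro k
  induction k with
  | zero =>
    intro a b α S _ _ _ _ _ _
    have he : {q : Fin 2 → ℝ | q 0 ∈ Set.Ioo a b ∧ 0 < q 1 ∧ q 1 < ∑ i, α i (q 0)} = ∅ := by
      ext q
      simp only [Finset.univ_eq_empty, Finset.sum_empty, mem_setOf_eq, mem_empty_iff_false,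
        iff_false, not_and, not_lt]
      exact fun _ h => h.le
    obtain ⟨T, hTd, hTi⟩ := KZ.exists_oneRep (n := 2)
      (σ := {q : Fin 2 → ℝ | q 0 ∈ Set.Ioo a b ∧ 0 < q 1 ∧ q 1 < ∑ i, α i (q 0)})
      (by rw [he]; exact isSemialgebraic_empty)
      (by rw [he, measure_empty]; exact ENNReal.zero_ne_top)
    refine ⟨T, hTd, fun q _ => by rw [hTi], ?_⟩
    rw [Finset.univ_eq_empty, Finset.sum_empty, sub_zero]
    exact KZ.of_mem_relations_of_volume_eq_zero T (by rw [hTd, he, measure_empty])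
  | succ k ih =>
    intro a b α S hab hsa hC hnn hSd hSi
    -- the partial sum `f := ∑_{i < k} αᵢ` (induction hypothesis) and the last band `g := α_k`
    obtain ⟨T₀, hT₀d, hT₀i, hT₀r⟩ := ih a b (fun i => α (Fin.castSucc i))
      (fun i => S (Fin.castSucc i)) hab (fun i => hsa _) (fun i => hC _) (fun i => hnn _)
      (fun i => hSd _) (fun i => hSi _)
    have hT₀d' : T₀.domain = {q | q 0 ∈ Set.Ioo a b ∧ 0 < q 1 ∧
        q 1 < (fun t => ∑ i : Fin k, α (Fin.castSucc i) t) (q 0)} := hT₀d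
    have hT₀r' : KZ.of T₀ - ∑ i : Fin k, KZ.of (S (Fin.castSucc i)) ∈ KZ.relations := hT₀r
    have hI : IsSemialgebraic ℚ {z : Fin 1 → ℝ | z 0 ∈ Set.Ioo a b} :=
      IsSemialgebraicFunOn.isSemialgebraic_holds (hsa (Fin.last k))
    have hfs : IsSemialgebraicFunOn ℚ {z : Fin 1 → ℝ | z 0 ∈ Set.Ioo a b}
        (fun z => (fun t => ∑ i : Fin k, α (Fin.castSucc i) t) (z 0)) :=
      sgStack_isSemialgebraicFunOn_sum hI k (fun i z => α (Fin.castSucc i) (z 0)) fun i => hsa _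
    have hfC : ContDiffOn ℝ 1 (fun t => ∑ i : Fin k, α (Fin.castSucc i) t) (Set.Ioo a b) :=
      ContDiffOn.sum fun i _ => hC _
    have hf0 : ∀ t ∈ Set.Ioo a b, 0 ≤ (fun t => ∑ i : Fin k, α (Fin.castSucc i) t) t :=
      fun t ht => Finset.sum_nonneg fun i _ => hnn _ t ht
    have hgC : ContDiffOn ℝ 1 (α (Fin.last k)) (Set.Ioo a b) := hC _
    -- the subgraph of `f + g`: semialgebraic, of area `area T₀ + area S_k < ∞`
    have hlt : ∀ r : KZ.IntegralRep 2, (∀ p ∈ r.domain, r.integrand p = 1) →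
        volume r.domain < ⊤ := fun r hr => by
      have hint : IntegrableOn (fun _ => (1 : ℝ)) r.domain :=
        r.integrableOn.congr_fun hr (KZ.IntegralRep.measurableSet_domain_holds r)
      have := (integrableOn_const_iff).1 hint
      simpa using this
    have hFs : IsSemialgebraicFunOn ℚ {z : Fin 1 → ℝ | z 0 ∈ Set.Ioo a b}
        (fun z => (fun t => ∑ i : Fin k, α (Fin.castSucc i) t) (z 0) + α (Fin.last k) (z 0)) :=
      IsSemialgebraicFunOn.add_holds hfs (hsa (Fin.last k))
    have hvol : volume {q : Fin 2 → ℝ | q 0 ∈ Set.Ioo a b ∧ 0 < q 1 ∧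
        q 1 < (fun t => ∑ i : Fin k, α (Fin.castSucc i) t) (q 0) + α (Fin.last k) (q 0)} ≠ ⊤ := by
      rw [sgStack_volume_subgraph (F := fun s => (fun t => ∑ i : Fin k, α (Fin.castSucc i) t) s +
          α (Fin.last k) s) (hfC.continuousOn.add hgC.continuousOn),
        setLIntegral_congr_fun measurableSet_Ioo
          (fun t ht => ENNReal.ofReal_add (hf0 t ht) (hnn _ t ht)),
        lintegral_add_left' (hfC.continuousOn.aemeasurable measurableSet_Ioo).ennreal_ofReal,
        ← sgStack_volume_subgraph hfC.continuousOn, ← sgStack_volume_subgraph hgC.continuousOn,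
        ← hT₀d', ← hSd (Fin.last k)]
      exact (ENNReal.add_lt_top.2 ⟨hlt T₀ hT₀i, hlt _ (hSi _)⟩).ne
    obtain ⟨T, hTd, hTi⟩ := KZ.exists_oneRep (sgStack_isSemialgebraic_subgraph
      (F := fun s => (fun t => ∑ i : Fin k, α (Fin.castSucc i) t) s + α (Fin.last k) s) hFs) hvol
    have hTi' : ∀ q ∈ T.domain, T.integrand q = 1 := fun q _ => by rw [hTi]
    refine ⟨T, ?_, hTi', ?_⟩
    · rw [hTd]
      ext q
      simp only [mem_setOf_eq, Fin.sum_univ_castSucc]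
    -- the stacking shear: `[T] − [T₀] − [S_k]` lies in the planar set-chain group `≤ relations`
    have key : KZ.of T - KZ.of T₀ - KZ.of (S (Fin.last k)) ∈ KZ.relations :=
      sgStack_shearGroup_le_relations
        (Summit.KontsevichZagierPeriods.SymplecticScissors.StackingShear.stackingShear_proof a b
          (fun t => ∑ i : Fin k, α (Fin.castSucc i) t) (α (Fin.last k)) hab hfs (hsa _) hfC hf0
          (hnn _) T T₀ (S (Fin.last k)) hTd hT₀d' (hSd _) hTi' hT₀i (hSi _))
    rw [Fin.sum_univ_castSucc]
    have heq : KZ.of T - (∑ i : Fin k, KZ.of (S (Fin.castSucc i)) + KZ.of (S (Fin.last k))) =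
        (KZ.of T - KZ.of T₀ - KZ.of (S (Fin.last k))) +
          (KZ.of T₀ - ∑ i : Fin k, KZ.of (S (Fin.castSucc i))) := by
      abel
    rw [heq]
    exact KZ.relations.add_mem key hT₀r'

end Summit.KontsevichZagierPeriods.SymplecticScissors.VolumeForm

end
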